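import Summits.HodgeConjecture.HodgeConjecture.Theorems.Ring2HypothesesDescentAbsoluteSemisimpleAlgebra
import Summits.HodgeConjecture.HodgeConjecture.Theorems.Ring2HypothesesDescentAlgebraicQuasiInverse
import HarnessLib

/-!
# Ring 2 — hypotheses layer, descent axis: EVERY ABSOLUTE HODGE CORRESPONDENCE HAS AN ABSOLUTE HODGE QUASI-INVERSE
# (`u v u = u`), between any two smooth projective complex varieties and any two degrees — Deligne–Milne II Prop. 6.5
# («every subobject is a direct summand») in operator form; retractions of injective and sections of surjective absolute
# Hodge correspondences; absolute Hodge classes in the range of an ABSOLUTE HODGE correspondence lift (mod the six facts)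

HONEST FRAMING (page 1, verbatim the cell's standing line): **research route conditional on HC_CM; not a
corollary; Q11.4-sentence-2 already refuted in dim ≥ 3.** Nothing in this file proves a case of the Hodge conjecture;
nothing discharges the binder of record b06 `Ring2.Hypotheses.AbsoluteHodgeImpliesAlgebraicAV` («absolute Hodge classes
on complex abelian varieties are algebraic», `Ring2HypothesesDescent.lean` :73; OPEN); the binder table's numbers do not
move. `HC_CM` (`Theses.RankFourFaces.CMAbelianHodge`) does not occur in this file; row b06 does not occur in this file.

Hodge ladder STAGE 3, `BINDER-OWNERS.md` row **b06**, seat `ring2-b06` (gen 78); third file of the gen after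
`…AbsoluteSemisimple` / `…AbsoluteSemisimpleAlgebra` (DM II Prop. 6.3 (Note) in operator form). The absolute-Hodge twin of
ring2-b05 gen 42's `Ring2HypothesesDescentAlgebraicQuasiInverse` («under `B(X)` every algebraic correspondence has an
algebraic quasi-inverse», the AbelianAll supply node (Q)): on the ABSOLUTE road no `B(X)` is needed, everything is modulo
the six named facts of record (N) `chartConjugation_canonical`, (E) existence of `σ`-conjugates, V-B3
`deligne1982_cycleClass_absoluteHodge`, T1c `deligne1982_lefschetz_absoluteHodge_iff`, CS7 `deligne1982_cupProduct_absoluteHodge`,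
CS8 `deligne1982_gysinFst_absoluteHodge`, displayed. «`T` is an ABSOLUTE HODGE CORRESPONDENCE» is written INLINE (no
definition): `∃ e hab γ, γ ∈ S^e(W ⊗ X) ∧ T = corrAction complexOrientationFamily hW hX hab γ`, `S := span_ℂ AH`.

* §1 calculus: algebraic correspondences (the tree's `IsAlgebraicCorrespondence`) are absolute Hodge correspondences
  (`exists_eq_corrAction_absoluteHodge_of_isAlgebraicCorrespondence`, mod V-B3); composition
  (`exists_eq_corrAction_absoluteHodge_comp`, the companion's one-class composition; mod (N)+(E)+V-B3+CS7+CS8).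
* §2 THE CORNER (verbatim gen 42's Morita corner with `A(Z ⊗ Z) ↦ S(Z ⊗ Z)` and Jannsen-under-`B` replaced by the
  companion's unconditional `isSemisimpleRing_adjoin_absoluteHodgeOperators`): absolute Hodge `ι : Hᵇ(X') ↪ Hᵏ(Z)`,
  `p : Hᵏ(Z) ↠ Hᵃ(X)` and `u : Hᵃ(X) → Hᵇ(X')` give an absolute Hodge `v` with `u v u = u` (von Neumann regularity
  `exists_mul_mul_self_eq_of_isSemisimpleRing` in the semisimple algebra of degree `k` on `Z`).
* §3 **`exists_absoluteHodge_quasiInverse_self`** — every absolute Hodge `u : Hᵃ(X) → Hᵇ(X)` (`a, b ≤ 2 dim X`) has an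
  absolute Hodge quasi-inverse: `Z := X × W`, `W` an ABELIAN VARIETY of dimension `|e − n|` padding the degrees (gen 42's
  slices `i = (𝟙, 0)`, `i_*`, `i^*`, `pr_X^*`, `pr_{X*}` — algebraic, hence absolute Hodge).
* §4 **`exists_absoluteHodge_quasiInverse` — TWO VARIETIES**: every absolute Hodge `u : Hᵃ(X) → Hᵇ(Y)` (`a ≤ 2 dim X`,
  `b ≤ 2 dim Y`) has an absolute Hodge quasi-inverse `v : Hᵇ(Y) → Hᵃ(X)`: compress to the endo-correspondence
  `U = pr_Y^* ∘ u ∘ pr_{X*}` of `Y × X` (injective / surjective by the slices at points `x₀ ∈ X(ℂ)`, `y₀ ∈ Y(ℂ)`), §3 on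
  `Y × X`, decompress.
* §5 CONSEQUENCES: **`exists_absoluteHodge_retraction_of_injective`** (an injective absolute Hodge correspondence has an
  absolute Hodge retraction `r ι = 1` — DM II 6.5 «subobjects are direct summands», realisation level),
  **`exists_absoluteHodge_section_of_surjective`** (`π s = 1`), and **`exists_mem_span_absoluteHodge_map_eq_of_absoluteHodge`**
  — a class of `S(Y)` in the range of an ABSOLUTE HODGE correspondence `u` lifts to `S(X)` (gen 76's
  `exists_mem_span_absoluteHodge_map_eq_of_isAlgebraicCorrespondence` had `u` ALGEBRAIC; gen 77's unit lift had `u = f^*`, `f`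
  surjective).

REVISION (gen 78, docstring-only; statements and proofs byte-identical): Deligne–Milne's semisimplicity Note follows
II Prop. 6.3, not 6.2 — locators corrected after the table pen's reading (lit-reduction g46, INBOX l.1724).

HONEST COLUMN. Nothing is discharged; «10 · 0» unchanged; row b06, `HC_AV`, `HC_CM` do not occur; the six facts occur only
as displayed hypotheses `hN`, `hex`, `hZ`, `hL`, `hcup`, `hgys`; no definition, no new named fact, no sorry. NOT obtained:
quasi-inverses for arbitrary orientation pairs (everything is normalised to `complexOrientationFamily`, as gens 76–77);
the `ℚ`-structure; anything for the ROW b06 itself — algebraicity moves only along ALGEBRAIC correspondences, so absolute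
Hodge quasi-inverses serve statement 11.2.17 (Hodge ⟹ absolute Hodge; the follow-up file) and the absolute road's
internal structure, not «absolute Hodge ⟹ algebraic».

PRESEARCH. «absolute Hodge correspondence quasi-inverse / retraction / direct summand» → [corpus: book:deligne1982-hodge-
cycles-motives-shimura-varieties p0148 L5–14 (proof of II 6.5: `(ai)⁻¹a` projects `M` on `N`), p0147 L32 (Lemma 6.6)];
corpus hybrid + galaxy all stars (the companion's queries): no operator-level statement in print ⇒ certification by
assembly of DM II 6.5 through ring2-b05 gen 42's corner; no novelty claimed. References (bib keys):
DeligneMilne1982Tannakian (II Prop. 6.1, 6.3 and Note, 6.5, Lemma 6.6), Jannsen1992 (Thm. 1), Andre1996Motifs (§2.1 p. 15, Prop. 3.3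
pp. 21–22, Appendix Remarque 1 p. 47), Fulton1998 (§16.1 Prop. 16.1.1, §10.1), FultonYoungTableaux1997 (App. B §B.1),
CharlesSchnell2014Notes (Prop. 11.2.8), Kleiman1968AlgebraicCycles (§3 Thm. 3.11).
-/

noncomputable section

set_option linter.dupNamespace false

open CategoryTheory AlgebraicGeometry MonoidalCategory CartesianMonoidalCategory
open Literature.AlgebraicTopology.SingularHomology Literature.Geometry.Kaehler
open Literature.AlgebraicGeometry Literature.AlgebraicGeometry.Motives
open Literature.AlgebraicGeometry.HodgeTheory
open Summit.HodgeConjecture.HodgeConjecture.Theorems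

namespace Summit.HodgeConjecture.HodgeConjecture.Ring2.Hypotheses

/-! ## §1 Absolute Hodge correspondences (inline): algebraic ones are, and they compose -/

section Calculus

variable {l m n : ℕ} {W X Y Z : SchemeOver ℂ}

/-- **An algebraic correspondence is an absolute Hodge correspondence** (mod V-B3): `T = [γ]_*` for the complex
orientations with `γ ∈ Nᵉ ⊆ S^e(W ⊗ X)` (ab-andre-2's `IsAlgebraicCorrespondence.exists_eq_corrAction`; Deligne Ex. 2.1 (a)).
[cite: Andre1996Motifs, §2.1 remark following Déf. 1 (p. 14)] [cite: Deligne1982HodgeCycles, §2 Example 2.1 (a) (p. 16)] -/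
theorem exists_eq_corrAction_absoluteHodge_of_isAlgebraicCorrespondence (hZ : deligne1982_cycleClass_absoluteHodge)
    (hW : IsSmoothProjective m W) (hX : IsSmoothProjective n X) {a b : ℕ}
    {T : complexBetti X a →ₗ[ℂ] complexBetti W b} (hT : IsAlgebraicCorrespondence m n W X T) :
    ∃ (e : ℕ) (hab : a + 2 * e = b + 2 * n) (γ : complexBetti (W ⊗ X) (2 * e)),
      γ ∈ Submodule.span ℂ {c : complexBetti (W ⊗ X) (2 * e) | IsAbsoluteHodgeClass (m + n) (W ⊗ X) e c} ∧
        T = corrAction complexOrientationFamily hW hX hab γ := by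
  obtain ⟨e, hab, γ, hγ, rfl⟩ :=
    Ring2.AbelianAll.IsAlgebraicCorrespondence.exists_eq_corrAction hW hX hT
  exact ⟨e, hab, γ, algebraicClasses_le_span_absoluteHodge hZ (IsSmoothProjective.tensor_holds hW hX) e hγ, rfl⟩

/-- **Composition of absolute Hodge correspondences is an absolute Hodge correspondence** (mod (N)+(E)+V-B3+CS7+CS8):
`T' : Hᵃ(Z) → H^{a₁}(Y)`, `T : H^{a₁}(Y) → H^{a₂}(X)` absolute Hodge, `a ≤ a₂ + 2 dim Z` ⟹ `T ∘ T'` absolute Hodge (the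
companion's one-class composition `exists_corrCompClass_mem_span_absoluteHodge`). Verbatim ab-andre-2's
`IsAlgebraicCorrespondence.comp` with `Nᵉ ↦ S^e`. [cite: DeligneMilne1982Tannakian, II Prop. 6.1 and §6.3]
[cite: Fulton1998, §16.1 Def. 16.1.1 and Prop. 16.1.1] -/
theorem exists_eq_corrAction_absoluteHodge_comp (hN : chartConjugation_canonical)
    (hex : ∀ ⦃n : ℕ⦄ ⦃X : SchemeOver ℂ⦄, IsSmoothProjective n X →
      ∀ (σ : ℂ ≃+* ℂ) (p : ℕ) (c : complexBetti X (2 * p)), ∃ s, IsConjugateClass σ X (2 * p) c s)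
    (hZ : deligne1982_cycleClass_absoluteHodge) (hcup : deligne1982_cupProduct_absoluteHodge)
    (hgys : deligne1982_gysinFst_absoluteHodge) (hX : IsSmoothProjective l X) (hY : IsSmoothProjective m Y)
    (hZ' : IsSmoothProjective n Z) {a a₁ a₂ : ℕ} {T' : complexBetti Z a →ₗ[ℂ] complexBetti Y a₁}
    {T : complexBetti Y a₁ →ₗ[ℂ] complexBetti X a₂}
    (hT' : ∃ (e : ℕ) (hab : a + 2 * e = a₁ + 2 * n) (γ : complexBetti (Y ⊗ Z) (2 * e)),
      γ ∈ Submodule.span ℂ {c : complexBetti (Y ⊗ Z) (2 * e) | IsAbsoluteHodgeClass (m + n) (Y ⊗ Z) e c} ∧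
        T' = corrAction complexOrientationFamily hY hZ' hab γ)
    (hT : ∃ (e : ℕ) (hab : a₁ + 2 * e = a₂ + 2 * m) (γ : complexBetti (X ⊗ Y) (2 * e)),
      γ ∈ Submodule.span ℂ {c : complexBetti (X ⊗ Y) (2 * e) | IsAbsoluteHodgeClass (l + m) (X ⊗ Y) e c} ∧
        T = corrAction complexOrientationFamily hX hY hab γ)
    (ha : a ≤ a₂ + 2 * n) :
    ∃ (e : ℕ) (hab : a + 2 * e = a₂ + 2 * n) (γ : complexBetti (X ⊗ Z) (2 * e)),
      γ ∈ Submodule.span ℂ {c : complexBetti (X ⊗ Z) (2 * e) | IsAbsoluteHodgeClass (l + n) (X ⊗ Z) e c} ∧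
        T ∘ₗ T' = corrAction complexOrientationFamily hX hZ' hab γ := by
  obtain ⟨e', h₁, γ', hγ', rfl⟩ := hT'
  obtain ⟨e, h₂, γ, hγ, rfl⟩ := hT
  obtain ⟨e'', he⟩ : ∃ e'' : ℕ, e + e' = e'' + m := ⟨e + e' - m, by omega⟩
  obtain ⟨γ'', hγ'', hact⟩ :=
    exists_corrCompClass_mem_span_absoluteHodge hN hex hZ hcup hgys hX hY hZ' he hγ hγ'
  exact ⟨e'', by omega, γ'', hγ'', (hact h₁ h₂ _).symm⟩

end Calculus

/-! ## §2 The corner: one semisimple algebra of absolute Hodge operators in ONE degree of an auxiliary `Z` suffices -/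

section Corner

variable {n n' N : ℕ} {X X' Z : SchemeOver ℂ}

/-- **Absolute Hodge quasi-inverses from the Morita corner** (mod the six facts). `X, X', Z` smooth projective of
dimensions `n, n', N`; `ι : Hᵇ(X') → Hᵏ(Z)` an INJECTIVE absolute Hodge correspondence, `p : Hᵏ(Z) → Hᵃ(X)` a SURJECTIVE
one (`b ≤ 2n'`, `k ≤ 2N`). Then every absolute Hodge `u : Hᵃ(X) → Hᵇ(X')` has an absolute Hodge `v : Hᵇ(X') → Hᵃ(X)` with
`u v u = u`: with linear retractions `p' ι = 1`, `p ι' = 1`, `U := ι u p` lies in the semisimple algebra of absolute Hodge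
operators on `Hᵏ(Z)` (the companion's `isSemisimpleRing_adjoin_absoluteHodgeOperators`), has a quasi-inverse `V` there
(von Neumann regularity, gen 42's `exists_mul_mul_self_eq_of_isSemisimpleRing`), `V` is absolute Hodge, and `v := p V ι`
satisfies `u v u = p'(U V U)ι' = p' U ι' = u`.
-- adapted from Summits/…/Theorems/Ring2HypothesesDescentAlgebraicQuasiInverse.lean (§2, ring2-b05 gen 42)
[cite: DeligneMilne1982Tannakian, II Prop. 6.5 (proof) and Lemma 6.6] [cite: Jannsen1992, Thm. 1]
[cite: Fulton1998, §16.1 Prop. 16.1.1] -/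
theorem exists_absoluteHodge_quasiInverse_of_injective_of_surjective (hN : chartConjugation_canonical)
    (hex : ∀ ⦃n : ℕ⦄ ⦃X : SchemeOver ℂ⦄, IsSmoothProjective n X →
      ∀ (σ : ℂ ≃+* ℂ) (p : ℕ) (c : complexBetti X (2 * p)), ∃ s, IsConjugateClass σ X (2 * p) c s)
    (hZ : deligne1982_cycleClass_absoluteHodge) (hL : deligne1982_lefschetz_absoluteHodge_iff)
    (hcup : deligne1982_cupProduct_absoluteHodge) (hgys : deligne1982_gysinFst_absoluteHodge)
    (hX : IsSmoothProjective n X) (hX' : IsSmoothProjective n' X') (hZ' : IsSmoothProjective N Z) {a b k : ℕ}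
    (hb : b ≤ 2 * n') (hk : k ≤ 2 * N)
    {ι : complexBetti X' b →ₗ[ℂ] complexBetti Z k} {p : complexBetti Z k →ₗ[ℂ] complexBetti X a}
    (hι : ∃ (e : ℕ) (hab : b + 2 * e = k + 2 * n') (γ : complexBetti (Z ⊗ X') (2 * e)),
      γ ∈ Submodule.span ℂ {c : complexBetti (Z ⊗ X') (2 * e) | IsAbsoluteHodgeClass (N + n') (Z ⊗ X') e c} ∧
        ι = corrAction complexOrientationFamily hZ' hX' hab γ)
    (hp : ∃ (e : ℕ) (hab : k + 2 * e = a + 2 * N) (γ : complexBetti (X ⊗ Z) (2 * e)),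
      γ ∈ Submodule.span ℂ {c : complexBetti (X ⊗ Z) (2 * e) | IsAbsoluteHodgeClass (n + N) (X ⊗ Z) e c} ∧
        p = corrAction complexOrientationFamily hX hZ' hab γ)
    (hιi : Function.Injective ι) (hps : Function.Surjective p)
    {u : complexBetti X a →ₗ[ℂ] complexBetti X' b}
    (hu : ∃ (e : ℕ) (hab : a + 2 * e = b + 2 * n) (γ : complexBetti (X' ⊗ X) (2 * e)),
      γ ∈ Submodule.span ℂ {c : complexBetti (X' ⊗ X) (2 * e) | IsAbsoluteHodgeClass (n' + n) (X' ⊗ X) e c} ∧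
        u = corrAction complexOrientationFamily hX' hX hab γ) :
    ∃ v : complexBetti X' b →ₗ[ℂ] complexBetti X a,
      (∃ (e : ℕ) (hab : b + 2 * e = a + 2 * n') (γ : complexBetti (X ⊗ X') (2 * e)),
        γ ∈ Submodule.span ℂ {c : complexBetti (X ⊗ X') (2 * e) | IsAbsoluteHodgeClass (n + n') (X ⊗ X') e c} ∧
          v = corrAction complexOrientationFamily hX hX' hab γ) ∧
      ∀ x : complexBetti X a, u (v (u x)) = u x := by
  -- linear retractions (no absolute Hodge property needed for these)
  obtain ⟨p', hpι⟩ := ι.exists_leftInverse_of_injective (LinearMap.ker_eq_bot.mpr hιi)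
  obtain ⟨ι', hpι'⟩ := p.exists_rightInverse_of_surjective (LinearMap.range_eq_top.mpr hps)
  -- the compressed operator `U = ι u p` on `Hᵏ(Z)` is an absolute Hodge self-correspondence of `Z`
  set U : complexBetti Z k →ₗ[ℂ] complexBetti Z k := ι ∘ₗ u ∘ₗ p with hUdef
  have hU : ∃ (e : ℕ) (hab : k + 2 * e = k + 2 * N) (γ : complexBetti (Z ⊗ Z) (2 * e)),
      γ ∈ Submodule.span ℂ {c : complexBetti (Z ⊗ Z) (2 * e) | IsAbsoluteHodgeClass (N + N) (Z ⊗ Z) e c} ∧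
        U = corrAction complexOrientationFamily hZ' hZ' hab γ := by
    have hup := exists_eq_corrAction_absoluteHodge_comp hN hex hZ hcup hgys hX' hX hZ' hp hu (by omega)
    have h := exists_eq_corrAction_absoluteHodge_comp hN hex hZ hcup hgys hZ' hX' hZ' hup hι (by omega)
    simpa only [hUdef, LinearMap.comp_assoc] using h
  obtain ⟨e, hke, Γ, hΓ, hUΓ⟩ := hU
  obtain rfl : N = e := by omega
  -- the semisimple operator algebra in degree `k`
  set M : Submodule ℂ (Module.End ℂ (complexBetti Z k)) :=
    (Submodule.span ℂ {c : complexBetti (Z ⊗ Z) (2 * N) | IsAbsoluteHodgeClass (N + N) (Z ⊗ Z) N c}).map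
      (corrAction complexOrientationFamily hZ' hZ' (rfl : k + 2 * N = k + 2 * N)) with hMdef
  set R : Subalgebra ℂ (Module.End ℂ (complexBetti Z k)) :=
    Algebra.adjoin ℂ (M : Set (Module.End ℂ (complexBetti Z k))) with hRdef
  haveI : IsSemisimpleRing R := isSemisimpleRing_adjoin_absoluteHodgeOperators hN hex hZ hL hcup hgys hZ' k
  have hRM : ∀ x : Module.End ℂ (complexBetti Z k), x ∈ R ↔ x ∈ M := fun x ↦ by
    rw [← SetLike.mem_coe, hRdef, hMdef, adjoin_absoluteHodgeOperators_eq hN hex hZ hcup hgys hZ' k, SetLike.mem_coe]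
  have hUM : U ∈ M := ⟨Γ, hΓ, hUΓ.symm⟩
  -- a quasi-inverse inside `R`
  obtain ⟨V, hV⟩ := exists_mul_mul_self_eq_of_isSemisimpleRing (R := R) ⟨U, (hRM U).mpr hUM⟩
  have hVM : (V : Module.End ℂ (complexBetti Z k)) ∈ M := (hRM _).mp V.2
  obtain ⟨Γ', hΓ', hVΓ'⟩ := hVM
  have hVah : ∃ (e : ℕ) (hab : k + 2 * e = k + 2 * N) (γ : complexBetti (Z ⊗ Z) (2 * e)),
      γ ∈ Submodule.span ℂ {c : complexBetti (Z ⊗ Z) (2 * e) | IsAbsoluteHodgeClass (N + N) (Z ⊗ Z) e c} ∧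
        (V : Module.End ℂ (complexBetti Z k)) = corrAction complexOrientationFamily hZ' hZ' hab γ :=
    ⟨N, rfl, Γ', hΓ', hVΓ'.symm⟩
  have hUVU : ∀ z : complexBetti Z k, U ((V : Module.End ℂ (complexBetti Z k)) (U z)) = U z := fun z ↦ by
    have h := congrArg (fun T : R ↦ (T : Module.End ℂ (complexBetti Z k)) z) hV
    simpa only [Subalgebra.coe_mul, Module.End.mul_apply] using h
  -- the quasi-inverse of `u`
  refine ⟨p ∘ₗ (V : Module.End ℂ (complexBetti Z k)) ∘ₗ ι, ?_, fun x ↦ ?_⟩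
  · have hVι := exists_eq_corrAction_absoluteHodge_comp hN hex hZ hcup hgys hZ' hZ' hX' hι hVah (by omega)
    have h := exists_eq_corrAction_absoluteHodge_comp hN hex hZ hcup hgys hX hZ' hX' hVι hp (by omega)
    simpa only [LinearMap.comp_assoc] using h
  · have hpι'x : p (ι' x) = x := by
      simpa only [LinearMap.comp_apply, LinearMap.id_apply] using LinearMap.congr_fun hpι' x
    have hp'ι : ∀ y : complexBetti X' b, p' (ι y) = y := fun y ↦ by
      simpa only [LinearMap.comp_apply, LinearMap.id_apply] using LinearMap.congr_fun hpι y
    have h := hUVU (ι' x)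
    simp only [hUdef, LinearMap.comp_apply, hpι'x] at h
    have h' := congrArg p' h
    rwa [hp'ι, hp'ι] at h'

end Corner

/-! ## §3 Self-correspondences between two degrees: padding by an abelian variety -/

section Self

variable {n : ℕ} {X : SchemeOver ℂ}

/-- **EVERY ABSOLUTE HODGE SELF-CORRESPONDENCE `u : Hᵃ(X(ℂ); ℂ) → Hᵇ(X(ℂ); ℂ)` (`a, b ≤ 2 dim X`) HAS AN ABSOLUTE HODGE
QUASI-INVERSE `v : Hᵇ → Hᵃ`, `u v u = u`** — mod the six facts; NO `B(X)` (compare gen 42's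
`algebraicQuasiInverseOfLefschetzStandard_holds`, the same construction under `B(X)` for algebraic correspondences). Write
`a + 2e = b + 2n`; `W` a complex abelian variety of dimension `|e − n|` (an elliptic curve if `e = n`), `Z := X × W`,
`i = (𝟙, 0) : X → Z`; if `e ≤ n` take `k := a`, `ι := i_*` (resp. `pr_X^*` if `e = n`), `p := i^*`; if `e > n` take `k := b`,
`ι := pr_X^*`, `p := pr_{X*}` — algebraic (`isAlgebraicCorrespondence_complexGysin` / `_map`), hence absolute Hodge (§1),
injective resp. surjective by `i ≫ pr_X = 𝟙` (gen 42's `complexGysin_fst_comp_complexGysin_sliceAt`, `map_sliceAt_comp_map_fst`);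
conclude by the corner §2. -- adapted from Summits/…/Theorems/Ring2HypothesesDescentAlgebraicQuasiInverse.lean (§4)
[cite: DeligneMilne1982Tannakian, II Prop. 6.5] [cite: Fulton1998, §10.1 and §16.1 Prop. 16.1.1]
[cite: FultonYoungTableaux1997, Appendix B §B.1 (1), (2), (5)] -/
theorem exists_absoluteHodge_quasiInverse_self (hN : chartConjugation_canonical)
    (hex : ∀ ⦃n : ℕ⦄ ⦃X : SchemeOver ℂ⦄, IsSmoothProjective n X →
      ∀ (σ : ℂ ≃+* ℂ) (p : ℕ) (c : complexBetti X (2 * p)), ∃ s, IsConjugateClass σ X (2 * p) c s)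
    (hZ : deligne1982_cycleClass_absoluteHodge) (hL : deligne1982_lefschetz_absoluteHodge_iff)
    (hcup : deligne1982_cupProduct_absoluteHodge) (hgys : deligne1982_gysinFst_absoluteHodge)
    (hX : IsSmoothProjective n X) {a b : ℕ} (ha : a ≤ 2 * n) (hb : b ≤ 2 * n)
    {u : complexBetti X a →ₗ[ℂ] complexBetti X b}
    (hu : ∃ (e : ℕ) (hab : a + 2 * e = b + 2 * n) (γ : complexBetti (X ⊗ X) (2 * e)),
      γ ∈ Submodule.span ℂ {c : complexBetti (X ⊗ X) (2 * e) | IsAbsoluteHodgeClass (n + n) (X ⊗ X) e c} ∧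
        u = corrAction complexOrientationFamily hX hX hab γ) :
    ∃ v : complexBetti X b →ₗ[ℂ] complexBetti X a,
      (∃ (e : ℕ) (hab : b + 2 * e = a + 2 * n) (γ : complexBetti (X ⊗ X) (2 * e)),
        γ ∈ Submodule.span ℂ {c : complexBetti (X ⊗ X) (2 * e) | IsAbsoluteHodgeClass (n + n) (X ⊗ X) e c} ∧
          v = corrAction complexOrientationFamily hX hX hab γ) ∧
      ∀ x : complexBetti X a, u (v (u x)) = u x := by
  have hu' := hu
  obtain ⟨e, hab, -, -, -⟩ := hu'
  have hPD := hasPoincareDuality_complexOrientationFamily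
  rcases Nat.lt_trichotomy e n with hlt | heq | hgt
  · -- `e < n`: `a = b + 2m`, `m = n - e`; embed `Hᵇ(X)` by `i_*` and project `Hᵃ(Z)` by `i^*`
    obtain ⟨W, hWd⟩ := exists_abelianVariety_dim_eq_succ ℂ (n - e - 1)
    have hm : e + W.dim = n := by omega
    have hW : IsSmoothProjective W.dim W.X := AbelianVariety.isSmoothProjective_holds (A := W)
    have hZ' : IsSmoothProjective (n + W.dim) (X ⊗ W.X) := hX.tensor_holds hW
    set w₀ : ComplexPoints W.X := (1 : W.Points ℂ)
    have h1 : b + 2 * (n + W.dim) = a + 2 * n := by omega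
    have h2 : a + 2 * n = b + 2 * (n + W.dim) := by omega
    refine exists_absoluteHodge_quasiInverse_of_injective_of_surjective hN hex hZ hL hcup hgys hX hX hZ' hb (k := a)
      (by omega)
      (exists_eq_corrAction_absoluteHodge_of_isAlgebraicCorrespondence hZ hZ' hX
        (isAlgebraicCorrespondence_complexGysin complexOrientationFamily hPD hX hZ' (sliceAt X w₀) h1
          (show a + (2 * (n + W.dim) - a) = 2 * (n + W.dim) by omega)))
      (exists_eq_corrAction_absoluteHodge_of_isAlgebraicCorrespondence hZ hX hZ'
        (isAlgebraicCorrespondence_map hX hZ' (sliceAt X w₀) ha)) ?_ ?_ hu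
    · exact Function.LeftInverse.injective (g := complexGysin complexOrientationFamily hZ' hX (fst X W.X) h2)
        fun x ↦ by
          simpa only [LinearMap.comp_apply, LinearMap.id_apply] using
            LinearMap.congr_fun (complexGysin_fst_comp_complexGysin_sliceAt hX hW w₀ h1 h2) x
    · exact Function.RightInverse.surjective (g := (complexBetti.map (fst X W.X) a).hom) fun x ↦ by
        simpa only [LinearMap.comp_apply, LinearMap.id_apply] using
          LinearMap.congr_fun (map_sliceAt_comp_map_fst (X := X) w₀ a) x
  · -- `e = n`: `a = b`; any elliptic curve `W`, embed and project in the same degree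
    subst heq
    obtain rfl : a = b := by omega
    obtain ⟨W, -⟩ := exists_abelianVariety_dim_eq_succ ℂ 0
    have hW : IsSmoothProjective W.dim W.X := AbelianVariety.isSmoothProjective_holds (A := W)
    have hZ' : IsSmoothProjective (e + W.dim) (X ⊗ W.X) := hX.tensor_holds hW
    set w₀ : ComplexPoints W.X := (1 : W.Points ℂ)
    refine exists_absoluteHodge_quasiInverse_of_injective_of_surjective hN hex hZ hL hcup hgys hX hX hZ' hb (k := a)
      (by omega)
      (exists_eq_corrAction_absoluteHodge_of_isAlgebraicCorrespondence hZ hZ' hX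
        (isAlgebraicCorrespondence_map hZ' hX (fst X W.X) (by omega)))
      (exists_eq_corrAction_absoluteHodge_of_isAlgebraicCorrespondence hZ hX hZ'
        (isAlgebraicCorrespondence_map hX hZ' (sliceAt X w₀) ha)) ?_ ?_ hu
    · exact Function.LeftInverse.injective (g := (complexBetti.map (sliceAt X w₀) a).hom) fun x ↦ by
        simpa only [LinearMap.comp_apply, LinearMap.id_apply] using
          LinearMap.congr_fun (map_sliceAt_comp_map_fst (X := X) w₀ a) x
    · exact Function.RightInverse.surjective (g := (complexBetti.map (fst X W.X) a).hom) fun x ↦ by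
        simpa only [LinearMap.comp_apply, LinearMap.id_apply] using
          LinearMap.congr_fun (map_sliceAt_comp_map_fst (X := X) w₀ a) x
  · -- `n < e`: `b = a + 2m`, `m = e - n`; embed `Hᵇ(X)` by `pr_X^*` and project `Hᵇ(Z)` by `pr_{X*}`
    obtain ⟨W, hWd⟩ := exists_abelianVariety_dim_eq_succ ℂ (e - n - 1)
    have hm : n + W.dim = e := by omega
    have hW : IsSmoothProjective W.dim W.X := AbelianVariety.isSmoothProjective_holds (A := W)
    have hZ' : IsSmoothProjective (n + W.dim) (X ⊗ W.X) := hX.tensor_holds hW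
    set w₀ : ComplexPoints W.X := (1 : W.Points ℂ)
    have h1 : a + 2 * (n + W.dim) = b + 2 * n := by omega
    have h2 : b + 2 * n = a + 2 * (n + W.dim) := by omega
    refine exists_absoluteHodge_quasiInverse_of_injective_of_surjective hN hex hZ hL hcup hgys hX hX hZ' hb (k := b)
      (by omega)
      (exists_eq_corrAction_absoluteHodge_of_isAlgebraicCorrespondence hZ hZ' hX
        (isAlgebraicCorrespondence_map hZ' hX (fst X W.X) (by omega)))
      (exists_eq_corrAction_absoluteHodge_of_isAlgebraicCorrespondence hZ hX hZ'
        (isAlgebraicCorrespondence_complexGysin complexOrientationFamily hPD hZ' hX (fst X W.X) h2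
          (show a + (2 * n - a) = 2 * n by omega))) ?_ ?_ hu
    · exact Function.LeftInverse.injective (g := (complexBetti.map (sliceAt X w₀) b).hom) fun x ↦ by
        simpa only [LinearMap.comp_apply, LinearMap.id_apply] using
          LinearMap.congr_fun (map_sliceAt_comp_map_fst (X := X) w₀ b) x
    · exact Function.RightInverse.surjective
        (g := complexGysin complexOrientationFamily hX hZ' (sliceAt X w₀) h1) fun x ↦ by
          simpa only [LinearMap.comp_apply, LinearMap.id_apply] using
            LinearMap.congr_fun (complexGysin_fst_comp_complexGysin_sliceAt hX hW w₀ h1 h2) x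

end Self

end Summit.HodgeConjecture.HodgeConjecture.Ring2.Hypotheses

end
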